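import Summits.CriticalPhenomena.PercolationContinuityZ3.Theorems.PercNearOneGluingNoHeavyLowerTailSahiCombTriWPrincipalCor
import Summits.CriticalPhenomena.PercolationContinuityZ3.Theorems.PercNearOneGluingNoHeavyLowerTailSahiCombTriWPerfectMinus
import Summits.CriticalPhenomena.PercolationContinuityZ3.Theorems.PercNearOneGluingNoHeavyLowerTailSahiCombTriWJSwitch

/-!
# The TWO-GENERATOR stratum of `TRI_W(a)`: `P = ↑g₁ ∪ ↑g₂` with `g₁ ∩ g₂ ≠ ∅`, `g₁ ∪ g₂ = univ` — the first stratum certified with a JOIN literal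

Support file of the one-cut programme (crux `NoHeavyLowerTail`, stmt-CriticalPhenomena-4575; TRI lane of cell `prim-masterthm`; seat prim-lf-1 gen 40,
memo `FROM-prim-lf-1-gen40-CYLINDER-AND-JSWITCH.md` §3).  Continuation of `…SahiCombTriWJSwitch` (the J-switch criterion), `…SahiCombHarrisEq`
(equality case of Harris–Kleitman) and `…SahiCombTriWPerfectMinus` (`card_inter_refl_lt_of_forall_essential`) and `…SahiCombTriWPrincipalCor` (`corP_upGen_eq`, `pieces_of_corP_upGen_zero`).

THEOREM (**`FiveUpSet.triW_nonneg_twoGen`**).  Let `g₁, g₂ ⊆ univ` with `g₁ ∩ g₂ ≠ ∅`, `g₁ ∪ g₂ = univ`, `g₁ ⊄ g₂`, `g₂ ⊄ g₁`, and `P = {t | g₁ ⊆ t ∨ g₂ ⊆ t}`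
(an intersecting up-set all of whose coordinates are essential; for `min(#(g₁\g₂), #(g₂\g₁)) ≥ 2` it is NOT relatively saturated, e.g. `↑023 ∪ ↑014 ⊆ 2^5`,
one of the 93 frontier classes of `2^5`).  Then `0 ≤ triW P F G` for every index cube and all monotone families of up-sets — via the J-SWITCH certificate
`κ = D_{P∖{g₂}} + J_{g₂} ⊗ J_{g₂}`, `J_{g₂}(A) = [g₂ ∈ A ∨ g₂ᶜ ∈ A]` (`jsVal P {g₂}`):
* (hi) `U_P − κ = [#(P∩C) − #(refl P∩C)] − (J_{g₂}(A)J_{g₂}(B) − [g₂∈A∩B])`, `C = A∩B`; the bracket is `≥ 1` on non-trivial `C` because every coordinate is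
  essential for `P` (`card_inter_refl_lt_of_forall_essential`);
* (lo) `κ − L_P = Cor_{↑g₁} + Cor_{↑g₂} − δ_A(W)δ_B(W) + J J − [g₂∈A∩B]` (`Cor_P = Cor_{↑g₁} + Cor_{↑g₂} − Cor_{{W}}`), where for a principal up-set
  `Cor_{↑g}(A,B) = #(↑g ∩ (A∖L_gA) ∩ (B∖L_gB)) + Kl(A∩↑g, L_gB) + Kl'(L_gA, B∩↑g) ≥ 0` with `L_gA = {t | t∖g ∈ A}` (`corP_principal_eq`, three non-negative
  terms: rearrangement + two Kleitman gaps in `W`); on the dangerous rows (`A, B` non-trivial, both `Cor`'s zero) the vanishing of the Kleitman gaps gives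
  disjoint essential supports (`inessential_or_of_kleitman_eq`), and a stripping argument (`mem_iff_sdiff_mem_of_inessential`) forces `J_{g₂}(A) = J_{g₂}(B) = 1`
  and `¬(g₂ ∈ A ∧ g₂ ∈ B)` (`jlit_of_corP_zero`, `not_both_of_corP_zero`).
Reusable for other single-switch strata: `jsVal_single` (the value of `κ_{{t}}` on an intersecting `P`) and **`jsVal_single_le_uForm`** — (hi) is AUTOMATIC for a
single J-switch on an intersecting family all of whose coordinates are essential, so such strata reduce to their (lo) inequality; and `sandwichCert_of_family`,
`sandwichCert_twoGen` (the certificate as a `SandwichCert`, ready for `sandwichCert_optCyl`).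
HONEST LABEL: complete proofs, std axioms; a new unconditional stratum of `TriWIneq` (all `n`, all `a`), the first one whose certificate uses a join literal;
`TriWIneq` itself stays OPEN. [this work]
-/

namespace Summit.CriticalPhenomena.PercolationContinuityZ3.Theorems

namespace FiveUpSet

open Finset

variable {β γ : Type} [DecidableEq β] [Fintype β] [DecidableEq γ] [Fintype γ]

/-! ### The two-generator family -/

/-- The two-generator up-set `↑g₁ ∪ ↑g₂ = {t | g₁ ⊆ t ∨ g₂ ⊆ t}`. [this work] -/
def twoGen (g₁ g₂ : Finset γ) : Finset (Finset γ) := univ.filter fun t => g₁ ⊆ t ∨ g₂ ⊆ t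

omit [DecidableEq β] [Fintype β] in
/-- Membership in `↑g₁ ∪ ↑g₂`. [this work] -/
@[simp] theorem mem_twoGen {g₁ g₂ t : Finset γ} : t ∈ twoGen g₁ g₂ ↔ g₁ ⊆ t ∨ g₂ ⊆ t := by simp [twoGen]

omit [DecidableEq β] [Fintype β] in
/-- `↑g₁ ∪ ↑g₂` is an up-set. [this work] -/
theorem isUpperSet_twoGen (g₁ g₂ : Finset γ) : IsUpperSet (twoGen g₁ g₂ : Set (Finset γ)) := by
  intro s t hst hs
  rw [mem_coe, mem_twoGen] at hs ⊢
  rcases hs with h | h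
  · exact Or.inl (h.trans hst)
  · exact Or.inr (h.trans hst)

omit [DecidableEq β] [Fintype β] in
/-- `↑g₁ ∪ ↑g₂` as a union of two principal up-sets. [this work] -/
theorem twoGen_eq_union (g₁ g₂ : Finset γ) : twoGen g₁ g₂ = upGen g₁ ∪ upGen g₂ := by
  ext t; simp [twoGen, upGen]

omit [DecidableEq β] [Fintype β] in
/-- With `g₁ ∪ g₂ = univ` the two principal up-sets meet only in the top point. [this work] -/
theorem upGen_inter_upGen {g₁ g₂ : Finset γ} (hU : g₁ ∪ g₂ = univ) : upGen g₁ ∩ upGen g₂ = {univ} := by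
  ext t
  rw [mem_inter, mem_upGen, mem_upGen, mem_singleton]
  constructor
  · rintro ⟨h1, h2⟩
    exact eq_univ_of_forall fun x => by
      have hx : x ∈ g₁ ∪ g₂ := hU ▸ mem_univ x
      rcases mem_union.1 hx with h | h
      · exact h1 h
      · exact h2 h
  · rintro rfl; exact ⟨subset_univ _, subset_univ _⟩



omit [DecidableEq β] [Fintype β] in
/-- `↑g₁ ∪ ↑g₂` is intersecting (meets its antipodal image trivially) when `g₁ ∩ g₂ ≠ ∅`. [this work] -/
theorem twoGen_inter_refl {g₁ g₂ : Finset γ} (hm : (g₁ ∩ g₂).Nonempty) : twoGen g₁ g₂ ∩ refl (twoGen g₁ g₂) = ∅ := by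
  obtain ⟨x, hx⟩ := hm
  rw [mem_inter] at hx
  refine eq_empty_of_forall_notMem fun s hs => ?_
  rw [mem_inter, mem_twoGen, mem_refl, mem_twoGen] at hs
  obtain ⟨h1, h2⟩ := hs
  have hxs : x ∈ s := by
    rcases h1 with h | h
    · exact h hx.1
    · exact h hx.2
  have hxs' : x ∈ sᶜ := by
    rcases h2 with h | h
    · exact h hx.1
    · exact h hx.2
  exact (mem_compl.1 hxs') hxs

omit [DecidableEq β] [Fintype β] in
/-- Every coordinate is essential for `↑g₁ ∪ ↑g₂` when neither generator contains the other and `g₁ ∪ g₂ = univ`. [this work] -/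
theorem essential_twoGen {g₁ g₂ : Finset γ} (hU : g₁ ∪ g₂ = univ) (h12 : ¬ g₁ ⊆ g₂) (h21 : ¬ g₂ ⊆ g₁) (k : γ) :
    ∃ s : Finset γ, k ∉ s ∧ insert k s ∈ twoGen g₁ g₂ ∧ s ∉ twoGen g₁ g₂ := by
  have hk : k ∈ g₁ ∨ k ∈ g₂ := mem_union.1 (hU ▸ mem_univ k)
  -- generic argument for a generator containing `k`
  have key : ∀ {a b : Finset γ}, k ∈ a → ¬ b ⊆ a →
      (k ∉ a.erase k ∧ insert k (a.erase k) ∈ twoGen a b ∧ a.erase k ∉ twoGen a b) := by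
    intro a b hka hba
    refine ⟨notMem_erase k a, ?_, ?_⟩
    · rw [insert_erase hka, mem_twoGen]; exact Or.inl le_rfl
    · rw [mem_twoGen, not_or]
      refine ⟨fun h => (notMem_erase k a) (h hka), fun h => hba (h.trans (erase_subset k a))⟩
  rcases hk with h | h
  · exact ⟨g₁.erase k, key h h21⟩
  · obtain ⟨h1, h2, h3⟩ := key (a := g₂) (b := g₁) h h12
    refine ⟨g₂.erase k, h1, ?_, ?_⟩
    · rw [mem_twoGen] at h2 ⊢; exact h2.symm
    · rw [mem_twoGen] at h3 ⊢; exact fun h' => h3 h'.symm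

omit [DecidableEq β] [Fintype β] in
/-- **The value of a single J-switch on an INTERSECTING family** (`P ∩ refl P = ∅`, `T = {t}`, `t ∈ P`):
`k(A,B) = #(P∩A∩B) − [t ∈ A∩B] + [t ∈ A ∨ tᶜ ∈ A]·[t ∈ B ∨ tᶜ ∈ B]`. [this work] -/
theorem jsVal_single {P : Finset (Finset γ)} (hQ : P ∩ refl P = ∅) {t : Finset γ} (ht : t ∈ P) (A B : Finset (Finset γ)) :
    jsVal P {t} A B
      = ((P ∩ A ∩ B).card : ℤ) - (if t ∈ A ∩ B then 1 else 0)
        + (if (t ∈ A ∨ tᶜ ∈ A) ∧ (t ∈ B ∨ tᶜ ∈ B) then 1 else 0) := by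
  unfold jsVal
  have hE : P \ refl P = P := by
    rw [Finset.sdiff_eq_self_iff_disjoint]; exact disjoint_iff_inter_eq_empty.2 hQ
  rw [hQ, empty_inter, empty_inter, card_empty, hE, sdiff_singleton_eq_erase]
  have h1 : ((P.erase t ∩ A ∩ B).card : ℤ) = ((P ∩ A ∩ B).card : ℤ) - (if t ∈ A ∩ B then 1 else 0) := by
    rw [inter_assoc, inter_assoc, erase_inter]
    by_cases h : t ∈ A ∩ B
    · rw [if_pos h]
      have := card_erase_add_one (mem_inter.2 ⟨ht, h⟩)
      omega
    · rw [if_neg h, erase_eq_of_notMem (fun h' => h (mem_inter.1 h').2)]; ring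
  have h2 : ((({t} : Finset (Finset γ)) ∩ (A ∪ refl A) ∩ (B ∪ refl B)).card : ℤ)
      = (if (t ∈ A ∨ tᶜ ∈ A) ∧ (t ∈ B ∨ tᶜ ∈ B) then 1 else 0) := by
    rw [inter_assoc]
    by_cases h : (t ∈ A ∨ tᶜ ∈ A) ∧ (t ∈ B ∨ tᶜ ∈ B)
    · rw [if_pos h, singleton_inter_of_mem, card_singleton]
      · rfl
      · simp only [mem_inter, mem_union, mem_refl]; exact h
    · rw [if_neg h, singleton_inter_of_notMem, card_empty]
      · rfl
      · simp only [mem_inter, mem_union, mem_refl]; exact h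
  rw [h1, h2]
  push_cast
  ring

omit [DecidableEq β] [Fintype β] in
/-- **(hi) is automatic for a single J-switch on an intersecting family all of whose coordinates are essential**: `k ≤ U_P`.
(The switch costs at most one unit, only on rows where `A ∩ B` is neither empty nor everything, and there the Kleitman gap of `(A∩B, P)` is `≥ 1`.)
This reduces every single-switch stratum to its (lo) inequality. [this work] -/
theorem jsVal_single_le_uForm {P : Finset (Finset γ)} (hP : IsUpperSet (P : Set (Finset γ))) (hQ : P ∩ refl P = ∅)
    (hess : ∀ k : γ, ∃ s : Finset γ, k ∉ s ∧ insert k s ∈ P ∧ s ∉ P) {t : Finset γ} (ht : t ∈ P)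
    {A B : Finset (Finset γ)} (hA : IsUpperSet (A : Set (Finset γ))) (hB : IsUpperSet (B : Set (Finset γ))) :
    jsVal P {t} A B ≤ uForm P A B := by
  rw [jsVal_single hQ ht]
  unfold uForm
  have hC : IsUpperSet ((A ∩ B : Finset (Finset γ)) : Set (Finset γ)) := by rw [coe_inter]; exact hA.inter hB
  have hk := card_inter_refl_le hC hP
  have e1 : refl P ∩ A ∩ B = A ∩ B ∩ refl P := by ext x; simp only [mem_inter]; tauto
  have e2 : P ∩ A ∩ B = A ∩ B ∩ P := by ext x; simp only [mem_inter]; tauto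
  have hk' : ((refl P ∩ A ∩ B).card : ℤ) ≤ ((P ∩ A ∩ B).card : ℤ) := by rw [e1, e2]; exact_mod_cast hk
  by_cases hJ : (t ∈ A ∨ tᶜ ∈ A) ∧ (t ∈ B ∨ tᶜ ∈ B)
  · rw [if_pos hJ]
    by_cases hg : t ∈ A ∩ B
    · rw [if_pos hg]; linarith
    · rw [if_neg hg]
      have hAne : (univ : Finset γ) ∈ A := by
        rcases hJ.1 with h | h
        · exact hA (subset_univ _) h
        · exact hA (subset_univ _) h
      have hBne : (univ : Finset γ) ∈ B := by
        rcases hJ.2 with h | h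
        · exact hB (subset_univ _) h
        · exact hB (subset_univ _) h
      have hlt := card_inter_refl_lt_of_forall_essential hP hC hess (mem_inter.2 ⟨hAne, hBne⟩) hg
      have hlt' : ((refl P ∩ A ∩ B).card : ℤ) < ((P ∩ A ∩ B).card : ℤ) := by rw [e1, e2]; exact_mod_cast hlt
      linarith
  · rw [if_neg hJ]
    have hg : t ∉ A ∩ B := fun h => hJ ⟨Or.inl (mem_inter.1 h).1, Or.inl (mem_inter.1 h).2⟩
    rw [if_neg hg]; linarith

/-! ### The two combinatorial lemmas on the dangerous rows -/

omit [DecidableEq β] [Fintype β] in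
/-- If `g₂ ∈ A ∩ B` (and `∅ ∉ A`, `∅ ∉ B`) then `Cor_{↑g₂}(A,B) ≠ 0`. [this work] -/
theorem not_both_of_corP_zero {g₂ : Finset γ} {A B : Finset (Finset γ)} (hA : IsUpperSet (A : Set (Finset γ)))
    (hB : IsUpperSet (B : Set (Finset γ))) (h0A : (∅ : Finset γ) ∉ A) (h0B : (∅ : Finset γ) ∉ B) (hz : corP (upGen g₂) A B = 0) :
    ¬ (g₂ ∈ A ∧ g₂ ∈ B) := by
  rintro ⟨hgA, hgB⟩
  obtain ⟨hR, -, -⟩ := pieces_of_corP_upGen_zero g₂ hA hB hz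
  rcases hR g₂ le_rfl hgA hgB with h | h
  · exact h0A (by rwa [sdiff_self] at h)
  · exact h0B (by rwa [sdiff_self] at h)

omit [DecidableEq β] [Fintype β] in
/-- **The join literal fires on the dangerous rows.**  If `g₁ ∪ g₂ = univ`, `A, B` are non-trivial up-sets (`univ ∈`, `∅ ∉`) and both
`Cor_{↑g₁}(A,B)` and `Cor_{↑g₂}(A,B)` vanish, then `g₂ ∈ A ∨ g₂ᶜ ∈ A`. [this work] -/
theorem jlit_of_corP_zero {g₁ g₂ : Finset γ} (hU : g₁ ∪ g₂ = univ) {A B : Finset (Finset γ)} (hA : IsUpperSet (A : Set (Finset γ)))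
    (hB : IsUpperSet (B : Set (Finset γ))) (hWA : (univ : Finset γ) ∈ A) (hWB : (univ : Finset γ) ∈ B) (h0B : (∅ : Finset γ) ∉ B)
    (hz1 : corP (upGen g₁) A B = 0) (hz2 : corP (upGen g₂) A B = 0) : g₂ ∈ A ∨ g₂ᶜ ∈ A := by
  classical
  by_contra hcon
  rw [not_or] at hcon
  obtain ⟨hgA, hgcA⟩ := hcon
  obtain ⟨hR1, -, -⟩ := pieces_of_corP_upGen_zero g₁ hA hB hz1
  obtain ⟨hR2, hKl2, -⟩ := pieces_of_corP_upGen_zero g₂ hA hB hz2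
  -- (a) `g₂ ∈ B`: the `g₁`-rearrangement piece at `s = univ` gives `univ \ g₁ ∈ A ∨ univ \ g₁ ∈ B`, and `univ \ g₁ ⊆ g₂`
  have hsub : univ \ g₁ ⊆ g₂ := by
    intro x hx
    rw [mem_sdiff] at hx
    rcases mem_union.1 (show x ∈ g₁ ∪ g₂ by rw [hU]; exact mem_univ x) with h | h
    · exact absurd h hx.2
    · exact h
  have hg₂B : g₂ ∈ B := by
    rcases hR1 univ (subset_univ _) hWA hWB with h | h
    · exact absurd (hA hsub h) hgA
    · exact hB hsub h
  -- (b) `g₂ᶜ ∈ B`: the `g₂`-rearrangement piece at `s = univ`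
  have hcB : univ \ g₂ ∈ B := by
    rcases hR2 univ (subset_univ _) hWA hWB with h | h
    · exact absurd (by rwa [← compl_eq_univ_sdiff] at h) hgcA
    · exact h
  -- (c) `X = A ∩ ↑g₂ ⊆ Y = L_{g₂} B`
  set X := A ∩ upGen g₂ with hX
  set Y := loTr g₂ B with hY
  have hXY : X ⊆ Y := by
    intro s hs
    rw [hX, mem_inter, mem_upGen] at hs
    rw [hY, mem_loTr]
    have hsB : s ∈ B := hB hs.2 hg₂B
    rcases hR2 s hs.2 hs.1 hsB with h | h
    · exact absurd (hA (by rw [compl_eq_univ_sdiff]; exact sdiff_subset_sdiff (subset_univ s) le_rfl) h) hgcA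
    · exact h
  -- (d) Harris equality for `(X, Y)`: every coordinate is inessential for `X` or for `Y`
  have hXu : IsUpperSet (X : Set (Finset γ)) := by rw [hX, coe_inter]; exact hA.inter (isUpperSet_upGen g₂)
  have hYu : IsUpperSet (Y : Set (Finset γ)) := isUpperSet_loTr g₂ hB
  have hIn := inessential_or_of_kleitman_eq hXu hYu hKl2
  -- (e) strip: `univ ∈ X`, remove the `Y`-essential coordinates (inessential for `X`), land in `Y`, then remove the rest
  set I := (univ : Finset γ).filter (fun k => ¬ Inessential k Y) with hI
  have hIX : ∀ k ∈ I, Inessential k X := by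
    intro k hk
    rw [hI, mem_filter] at hk
    rcases hIn k with h | h
    · exact h
    · exact absurd h hk.2
  have hIcY : ∀ k ∈ univ \ I, Inessential k Y := by
    intro k hk
    rw [mem_sdiff, hI, mem_filter, not_and, not_not] at hk
    exact hk.2 hk.1
  have hWX : (univ : Finset γ) ∈ X := by rw [hX, mem_inter, mem_upGen]; exact ⟨hWA, subset_univ _⟩
  have h1 : univ \ I ∈ X := (mem_iff_sdiff_mem_of_inessential hIX univ).1 hWX
  have h2 : univ \ I ∈ Y := hXY h1
  have h3 : (univ \ I) \ (univ \ I) ∈ Y := (mem_iff_sdiff_mem_of_inessential hIcY (univ \ I)).1 h2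
  rw [sdiff_self, hY, mem_loTr] at h3
  exact h0B (by simpa using h3)

/-! ### The two sandwich inequalities and the theorem -/

omit [DecidableEq β] [Fintype β] in
/-- (lo): `L_P ≤ k` for the two-generator family. [this work] -/
theorem lForm_le_jsVal_twoGen {g₁ g₂ : Finset γ} (hm : (g₁ ∩ g₂).Nonempty) (hU : g₁ ∪ g₂ = univ)
    {A B : Finset (Finset γ)} (hA : IsUpperSet (A : Set (Finset γ))) (hB : IsUpperSet (B : Set (Finset γ))) :
    lForm (twoGen g₁ g₂) A B ≤ jsVal (twoGen g₁ g₂) {g₂} A B := by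
  have hg₂ : g₂ ∈ twoGen g₁ g₂ := by rw [mem_twoGen]; exact Or.inr le_rfl
  rw [jsVal_single (twoGen_inter_refl hm) hg₂, lForm_eq_card_sub_corP, twoGen_eq_union, corP_union, upGen_inter_upGen hU, corP_singleton_univ,
    ← twoGen_eq_union]
  have c1 := corP_upGen_nonneg g₁ hA hB
  have c2 := corP_upGen_nonneg g₂ hA hB
  -- the sign product at the top point
  have hWu : (univ : Finset γ) ∈ refl A ↔ (∅ : Finset γ) ∈ A := by rw [mem_refl, compl_univ]
  have hWuB : (univ : Finset γ) ∈ refl B ↔ (∅ : Finset γ) ∈ B := by rw [mem_refl, compl_univ]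
  by_cases htop : (univ : Finset γ) ∈ A ∧ (∅ : Finset γ) ∉ A ∧ (univ : Finset γ) ∈ B ∧ (∅ : Finset γ) ∉ B
  · obtain ⟨hWA, h0A, hWB, h0B⟩ := htop
    have hs : sgnDiff A (refl A) univ * sgnDiff B (refl B) univ = 1 := by
      unfold sgnDiff; rw [if_pos hWA, if_pos hWB, if_neg (fun h => h0A (hWu.1 h)), if_neg (fun h => h0B (hWuB.1 h))]; ring
    rw [hs]
    by_cases hzero : corP (upGen g₁) A B = 0 ∧ corP (upGen g₂) A B = 0
    · -- dangerous row: the join literal fires on both sides and `g₂` is not in both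
      have jA := jlit_of_corP_zero hU hA hB hWA hWB h0B hzero.1 hzero.2
      have jB := jlit_of_corP_zero hU hB hA hWB hWA h0A (by rw [corP_comm]; exact hzero.1) (by rw [corP_comm]; exact hzero.2)
      have nb := not_both_of_corP_zero hA hB h0A h0B hzero.2
      rw [if_neg (show g₂ ∉ A ∩ B from fun h => nb (mem_inter.1 h)),
        if_pos (show (g₂ ∈ A ∨ g₂ᶜ ∈ A) ∧ (g₂ ∈ B ∨ g₂ᶜ ∈ B) from ⟨jA, jB⟩)]
      linarith [hzero.1, hzero.2]
    · have hpos : 1 ≤ corP (upGen g₁) A B + corP (upGen g₂) A B := by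
        rcases not_and_or.1 hzero with h | h
        · have : 0 < corP (upGen g₁) A B := lt_of_le_of_ne c1 (Ne.symm h); linarith
        · have : 0 < corP (upGen g₂) A B := lt_of_le_of_ne c2 (Ne.symm h); linarith
      have hJ : (if g₂ ∈ A ∩ B then (1:ℤ) else 0) ≤ (if (g₂ ∈ A ∨ g₂ᶜ ∈ A) ∧ (g₂ ∈ B ∨ g₂ᶜ ∈ B) then 1 else 0) := by
        by_cases h : g₂ ∈ A ∩ B
        · rw [if_pos h, if_pos ⟨Or.inl (mem_inter.1 h).1, Or.inl (mem_inter.1 h).2⟩]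
        · rw [if_neg h]; split_ifs <;> norm_num
      linarith
  · -- the top sign product is `≤ 0`
    have hs : sgnDiff A (refl A) univ * sgnDiff B (refl B) univ ≤ 0 := by
      have e0A : (∅ : Finset γ) ∈ A → (univ : Finset γ) ∈ A := fun h => hA (empty_subset _) h
      have e0B : (∅ : Finset γ) ∈ B → (univ : Finset γ) ∈ B := fun h => hB (empty_subset _) h
      unfold sgnDiff
      simp only [hWu, hWuB]
      by_cases a1 : (univ : Finset γ) ∈ A <;> by_cases a0 : (∅ : Finset γ) ∈ A <;> by_cases b1 : (univ : Finset γ) ∈ B <;>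
        by_cases b0 : (∅ : Finset γ) ∈ B <;> (simp [a1, a0, b1, b0] at htop ⊢; try tauto)
    have hJ : (if g₂ ∈ A ∩ B then (1:ℤ) else 0) ≤ (if (g₂ ∈ A ∨ g₂ᶜ ∈ A) ∧ (g₂ ∈ B ∨ g₂ᶜ ∈ B) then 1 else 0) := by
      by_cases h : g₂ ∈ A ∩ B
      · rw [if_pos h, if_pos ⟨Or.inl (mem_inter.1 h).1, Or.inl (mem_inter.1 h).2⟩]
      · rw [if_neg h]; split_ifs <;> norm_num
    linarith

omit [DecidableEq β] [Fintype β] in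
/-- (hi): `k ≤ U_P` for the two-generator family (a single switch on an intersecting, all-essential family). [this work] -/
theorem jsVal_le_uForm_twoGen {g₁ g₂ : Finset γ} (hm : (g₁ ∩ g₂).Nonempty) (hU : g₁ ∪ g₂ = univ) (h12 : ¬ g₁ ⊆ g₂) (h21 : ¬ g₂ ⊆ g₁)
    {A B : Finset (Finset γ)} (hA : IsUpperSet (A : Set (Finset γ))) (hB : IsUpperSet (B : Set (Finset γ))) :
    jsVal (twoGen g₁ g₂) {g₂} A B ≤ uForm (twoGen g₁ g₂) A B :=
  jsVal_single_le_uForm (isUpperSet_twoGen g₁ g₂) (twoGen_inter_refl hm) (essential_twoGen hU h12 h21)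
    (by rw [mem_twoGen]; exact Or.inr le_rfl) hA hB

/-- **`TriWIneq` ON THE TWO-GENERATOR STRATUM.**  For `g₁ ∩ g₂ ≠ ∅`, `g₁ ∪ g₂ = univ`, `g₁ ⊄ g₂`, `g₂ ⊄ g₁`, the up-set
`P = ↑g₁ ∪ ↑g₂` satisfies `0 ≤ triW P F G` for EVERY index cube and all monotone families of up-sets — certified by Formula A with the
diagonal unit at `g₂` switched to the antipodal join literal. [this work] -/
theorem triW_nonneg_twoGen {g₁ g₂ : Finset γ} (hm : (g₁ ∩ g₂).Nonempty) (hU : g₁ ∪ g₂ = univ) (h12 : ¬ g₁ ⊆ g₂) (h21 : ¬ g₂ ⊆ g₁)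
    (F G : Finset β → Finset (Finset γ))
    (hF : ∀ x, IsUpperSet (F x : Set (Finset γ))) (hG : ∀ x, IsUpperSet (G x : Set (Finset γ)))
    (hFm : Monotone F) (hGm : Monotone G) :
    0 ≤ triW (twoGen g₁ g₂) F G := by
  have hT : ({g₂} : Finset (Finset γ)) ⊆ twoGen g₁ g₂ \ refl (twoGen g₁ g₂) := by
    intro t ht
    rw [mem_singleton] at ht
    rw [ht, mem_sdiff]
    have hg : g₂ ∈ twoGen g₁ g₂ := by rw [mem_twoGen]; exact Or.inr le_rfl
    refine ⟨hg, fun h => ?_⟩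
    have : g₂ ∈ twoGen g₁ g₂ ∩ refl (twoGen g₁ g₂) := mem_inter.2 ⟨hg, h⟩
    rw [twoGen_inter_refl hm] at this
    exact notMem_empty _ this
  exact triW_nonneg_of_jswitch hT (fun A B hA hB => lForm_le_jsVal_twoGen hm hU hA hB)
    (fun A B hA hB => jsVal_le_uForm_twoGen hm hU h12 h21 hA hB) F G hF hG hFm hGm

omit [DecidableEq β] [Fintype β] in
/-- The sandwich hypotheses of an `ι`-indexed literal family, packaged as a `Fin k`-indexed `SandwichCert` (transport along `Fintype.equivFin`), so that
certificates built from `litValI` can be fed to `sandwichCert_optCyl` (cylinders) and other `SandwichCert` consumers. [this work] -/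
theorem sandwichCert_of_family {ι : Type} [Fintype ι] {P : Finset (Finset γ)} {c : ℕ} {lam : ι → ℕ} {V B : ι → (Finset (Finset γ) → Bool)}
    (hcert : ∀ A Bs : Finset (Finset γ), IsUpperSet (A : Set (Finset γ)) → IsUpperSet (Bs : Set (Finset γ)) →
      (c : ℤ) * lForm P A Bs ≤ litValI lam V B A Bs ∧ litValI lam V B A Bs ≤ (c : ℤ) * uForm P A Bs) :
    SandwichCert P c (fun j => lam ((Fintype.equivFin ι).symm j)) (fun j => V ((Fintype.equivFin ι).symm j))
      (fun j => B ((Fintype.equivFin ι).symm j)) := by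
  intro A Bs hA hBs
  rw [← litValI_eq_litVal]
  exact hcert A Bs hA hBs

/-- **The two-generator certificate as a `SandwichCert`** (for cylinder lifting via `sandwichCert_optCyl`). [this work] -/
theorem sandwichCert_twoGen {g₁ g₂ : Finset γ} (hm : (g₁ ∩ g₂).Nonempty) (hU : g₁ ∪ g₂ = univ) (h12 : ¬ g₁ ⊆ g₂) (h21 : ¬ g₂ ⊆ g₁) :
    SandwichCert (twoGen g₁ g₂) 1 (fun j => jsLam (twoGen g₁ g₂) ((Fintype.equivFin (Finset γ)).symm j))
      (fun j => jsV {g₂} ((Fintype.equivFin (Finset γ)).symm j)) (fun j => jsB (twoGen g₁ g₂) {g₂} ((Fintype.equivFin (Finset γ)).symm j)) := by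
  have hT : ({g₂} : Finset (Finset γ)) ⊆ twoGen g₁ g₂ \ refl (twoGen g₁ g₂) := by
    intro t ht
    rw [mem_singleton] at ht
    rw [ht, mem_sdiff]
    have hg : g₂ ∈ twoGen g₁ g₂ := by rw [mem_twoGen]; exact Or.inr le_rfl
    refine ⟨hg, fun h => ?_⟩
    have : g₂ ∈ twoGen g₁ g₂ ∩ refl (twoGen g₁ g₂) := mem_inter.2 ⟨hg, h⟩
    rw [twoGen_inter_refl hm] at this
    exact notMem_empty _ this
  refine sandwichCert_of_family fun A Bs hA hBs => ?_
  rw [litValI_js hT, Nat.cast_one, one_mul, one_mul]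
  exact ⟨lForm_le_jsVal_twoGen hm hU hA hBs, jsVal_le_uForm_twoGen hm hU h12 h21 hA hBs⟩

end FiveUpSet

end Summit.CriticalPhenomena.PercolationContinuityZ3.Theorems
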